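import Summits.Ventures.CertifiedArithmetic.LowPrec.SRDyadicThresholds
import HarnessLib

/-!
# Every `N`-bit rule is biased at a non-dyadic state; one bit short at a negative state

HONEST FRAMING: certified error envelopes and provably optimal rounding/accumulation schemes for
low-precision formats under stated cost models; every table by two implementations; no hardware or
vendor claims.

File LXXXVIII of the SR slice — the NECESSITY half of the random-bit thresholds (files LXXX–LXXXVII)
in its rule-independent form, for any finite number system `F` over an ordered field.

1. **Every `N`-bit rule is biased at a non-dyadic state** (`stepQ_id_ne_clamp_of_not_dyadic`,
   `stepQ_ABC_id_ne_of_not_dyadic`): if the rule's away-probabilities are `N`-bit dyadics — true of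
   `StochasticA/B/C` (`dyadic_probAwayA/B/C`) and of any rule that compares `N` random bits with
   a threshold — and the exact up-probability `pUp F c` is NOT an `N`-bit dyadic, then the one-step
   mean `E[SR_q(c)]` differs from the exact-SR mean `clamp F c`, whatever the sign of `c`.  This
   is the form in which "not an `(L−1)`-bit dyadic" in the threshold theorems means "the law is
   wrong one bit short" for `A`, `B` AND `C` at once.
2. **One bit short at a NEGATIVE state** (`pUpQ_of_dn_neg`, `probAwayA/C_one_sub_half`,
   `pUpQ_A/B/C_neg_half`, `stepQ_ABC_id_neg_half`).  The rules act on the AWAY-from-zero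
   probability, which below zero is `1 − θ` (`pUpQ`, file LV).  At a negative state with
   `θ = pUp F c = 2^−(N+1)`, rule `A` with `N` bits rounds UP (toward zero) with probability `2θ` —
   twice too often, mean `c̄ + (c̄ − ⌊c̄⌋)`, error `+θ·gap` — while rules `B` and `C` (`N ≥ 1`;
   for `C` the tie `2^N − ½` goes to the even `2^N`) never round up: mean `⌊c̄⌋`, error `−θ·gap`.
   (On the nonnegative side the roles flip: `A` and `C` never round up, `B` doubles —
   `probAwayA/C_eq_zero`, `probAwayB_half` of file LVI.)  File LXXXIX applies this to the format
   witnesses `−maxRat + q`, `−maxRat + q²` of files LXXXII/LXXXVI/LXXXVII and corrects the wording.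
Helpers: `dyadic_pUpQ`, `dn_ne_up_of_pUp_ne_zero`, `pUp_mul_gap`, `stepQ_id_eq`, `stepQ_of_mem`,
`stepQ_congr_mem`, `stepQ_id_of_pUpQ_two_mul`, `stepQ_id_of_pUpQ_zero`.
-/

namespace Summit.Ventures.CertifiedArithmetic.LowPrec.SR.LimitedBits

open Literature.ComputerArithmetic.P3109
open Literature.ComputerArithmetic.ConnollyHighamMary2021
open Literature.ComputerArithmetic.FloatingPoint (Format MiniFloat)
open Literature.ComputerArithmetic.FloatingPoint.MiniFloat (valueSet valueSet_nonempty)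
open Summit.Ventures.CertifiedArithmetic.LowPrec.SR
open Finset STree

section Generic

variable {K : Type*} [Field K] [LinearOrder K] [IsStrictOrderedRing K] [FloorRing K]

/-! ### Every `N`-bit rule outputs `N`-bit dyadics, hence is biased at a non-dyadic state -/

/-- `StochasticA`'s away-probability is an `N`-bit dyadic. -/
theorem dyadic_probAwayA (N : ℕ) (η : K) : Dyadic N (probAwayA N η) :=
  ⟨⌊η * 2 ^ N⌋, by unfold probAwayA; rw [div_mul_cancel₀ _ (by positivity)]⟩

/-- `StochasticB`'s away-probability is an `N`-bit dyadic. -/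
theorem dyadic_probAwayB (N : ℕ) (η : K) : Dyadic N (probAwayB N η) :=
  ⟨⌊η * 2 ^ N + 1 / 2⌋, by unfold probAwayB; rw [div_mul_cancel₀ _ (by positivity)]⟩

/-- `StochasticC`'s away-probability is an `N`-bit dyadic. -/
theorem dyadic_probAwayC (N : ℕ) (η : K) : Dyadic N (probAwayC N η) :=
  ⟨rnite (η * 2 ^ N), by unfold probAwayC; rw [div_mul_cancel₀ _ (by positivity)]⟩

omit [IsStrictOrderedRing K] [FloorRing K] in
/-- On the negative side "away from zero" is "down": `P_q(up) = 1 − q(1 − θ)`. -/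
theorem pUpQ_of_dn_neg (F : Finset K) (q : K → K) {c : K} (h : dn F c < 0) :
    pUpQ F q c = 1 - q (1 - pUp F c) := if_neg (not_le.mpr h)

omit [IsStrictOrderedRing K] [FloorRing K] in
/-- A rule with `N`-dyadic away-probabilities has an `N`-dyadic up-probability at every state. -/
theorem dyadic_pUpQ (F : Finset K) {q : K → K} {N : ℕ} (hq : ∀ η, Dyadic N (q η)) (c : K) :
    Dyadic N (pUpQ F q c) := by
  unfold pUpQ
  split_ifs
  · exact hq _
  · exact dyadic_one_sub (hq _)

omit [IsStrictOrderedRing K] [FloorRing K] in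
/-- A positive up-probability means two distinct candidates. -/
theorem dn_ne_up_of_pUp_ne_zero {F : Finset K} {c : K} (h : pUp F c ≠ 0) : dn F c ≠ up F c := by
  intro e
  apply h
  unfold pUp probUp
  unfold dn up at e
  rw [e, sub_self, div_zero]

omit [IsStrictOrderedRing K] [FloorRing K] in
/-- `θ · gap = c̄ − ⌊c̄⌋` when the candidates differ. -/
theorem pUp_mul_gap {F : Finset K} {c : K} (h : dn F c ≠ up F c) :
    pUp F c * (up F c - dn F c) = clamp F c - dn F c := by
  unfold pUp probUp
  unfold dn up at h ⊢
  rw [div_mul_cancel₀ _ (sub_ne_zero.mpr (Ne.symm h))]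

omit [FloorRing K] in
/-- The one-step mean under a rule: `E[SR_q(c)] = c̄ + (P_q(up) − θ)·gap`. -/
theorem stepQ_id_eq (F : Finset K) (q : K → K) (c : K) :
    stepQ F q c (fun t => t) = clamp F c + (pUpQ F q c - pUp F c) * (up F c - dn F c) := by
  have := stepQ_id_sub F q c
  linarith

omit [IsStrictOrderedRing K] [FloorRing K] in
/-- A step at a representable value returns it surely, under any rule. -/
theorem stepQ_of_mem {F : Finset K} (q : K → K) {x : K} (hx : x ∈ F) (g : K → K) :
    stepQ F q x g = g x := by
  have hc : clamp F x = x := clamp_eq_self ⟨⟨x, hx, le_rfl⟩, ⟨x, hx, le_rfl⟩⟩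
  have hu : up F x = x := by unfold up; rw [hc, roundUp_eq_self_of_mem hx]
  have hd : dn F x = x := by unfold dn; rw [hc, roundDown_eq_self_of_mem hx]
  unfold stepQ; rw [hu, hd]; ring

omit [FloorRing K] in
/-- **Every `N`-bit rule is biased at a non-`N`-dyadic state.**  If the rule's away-probabilities
are `N`-bit dyadics and the exact up-probability of `c` is not, the one-step mean differs from the
exact-SR mean `c̄ = clamp F c` (`= step F c id`, `step_id`). -/
theorem stepQ_id_ne_clamp_of_not_dyadic {F : Finset K} {q : K → K} {N : ℕ}
    (hq : ∀ η, Dyadic N (q η)) {c : K} (hθ : ¬ Dyadic N (pUp F c)) :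
    stepQ F q c (fun t => t) ≠ clamp F c := by
  intro h
  have h1 := stepQ_id_sub F q c
  rw [h, sub_self] at h1
  rcases mul_eq_zero.mp h1.symm with h2 | h2
  · exact hθ (sub_eq_zero.mp h2 ▸ dyadic_pUpQ F hq c)
  · have h0 : pUp F c = 0 := by
      by_contra hne
      exact dn_ne_up_of_pUp_ne_zero hne (sub_eq_zero.mp h2).symm
    exact hθ (h0 ▸ ⟨0, by simp⟩)

omit [FloorRing K] in
/-- The same against the exact-SR step: `E_q[SR(c)] ≠ E[SR(c)]`. -/
theorem stepQ_id_ne_step_id_of_not_dyadic {F : Finset K} {q : K → K} {N : ℕ}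
    (hq : ∀ η, Dyadic N (q η)) {c : K} (hθ : ¬ Dyadic N (pUp F c)) :
    stepQ F q c (fun t => t) ≠ step F c (fun t => t) := by
  rw [step_id]; exact stepQ_id_ne_clamp_of_not_dyadic hq hθ

/-- **The three P3109 rules, `N` bits, at a non-`N`-dyadic state: all three biased.** -/
theorem stepQ_ABC_id_ne_of_not_dyadic {F : Finset K} {N : ℕ} {c : K} (hθ : ¬ Dyadic N (pUp F c)) :
    stepQ F (probAwayA N) c (fun t => t) ≠ clamp F c ∧
    stepQ F (probAwayB N) c (fun t => t) ≠ clamp F c ∧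
    stepQ F (probAwayC N) c (fun t => t) ≠ clamp F c :=
  ⟨stepQ_id_ne_clamp_of_not_dyadic (dyadic_probAwayA N) hθ,
    stepQ_id_ne_clamp_of_not_dyadic (dyadic_probAwayB N) hθ,
    stepQ_id_ne_clamp_of_not_dyadic (dyadic_probAwayC N) hθ⟩

/-! ### One bit short at a NEGATIVE state: `A` doubles, `B` and `C` never round up -/

/-- `StochasticA` at the away-probability `1 − 2^−(N+1)`: `1 − 2^−N`. -/
theorem probAwayA_one_sub_half (N : ℕ) :
    probAwayA N (1 - (1 : K) / 2 ^ (N + 1)) = 1 - 1 / 2 ^ N := by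
  have hX : (1 - (1 : K) / 2 ^ (N + 1)) * 2 ^ N = 2 ^ N - 1 / 2 := by
    rw [pow_succ]; field_simp
  have hfl : ⌊(2 : K) ^ N - 1 / 2⌋ = 2 ^ N - 1 := by
    rw [Int.floor_eq_iff]; push_cast; constructor <;> linarith
  unfold probAwayA
  rw [hX, hfl]; push_cast; field_simp

/-- `StochasticC` at the away-probability `1 − 2^−(N+1)`, `N ≥ 1`: the tie `2^N − ½` goes to the
EVEN integer `2^N`, so the rule rounds away surely. -/
theorem probAwayC_one_sub_half {N : ℕ} (hN : 1 ≤ N) :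
    probAwayC N (1 - (1 : K) / 2 ^ (N + 1)) = 1 := by
  have hX : (1 - (1 : K) / 2 ^ (N + 1)) * 2 ^ N = 2 ^ N - 1 / 2 := by
    rw [pow_succ]; field_simp
  have hfl : ⌊(2 : K) ^ N - 1 / 2⌋ = 2 ^ N - 1 := by
    rw [Int.floor_eq_iff]; push_cast; constructor <;> linarith
  have hodd : Odd ((2 : ℤ) ^ N - 1) := by
    obtain ⟨k, rfl⟩ := Nat.exists_eq_add_of_le' hN
    exact ⟨2 ^ k - 1, by rw [pow_succ]; ring⟩
  have hr : rnite ((2 : K) ^ N - 1 / 2) = 2 ^ N := by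
    unfold rnite; rw [hfl]
    have e1 : ¬ ((2 : K) ^ N - 1 / 2 < (((2 : ℤ) ^ N - 1 : ℤ) : K) + 1 / 2) := by
      push_cast; intro h; linarith
    have e2 : ¬ ((((2 : ℤ) ^ N - 1 : ℤ) : K) + 1 / 2 < (2 : K) ^ N - 1 / 2) := by
      push_cast; intro h; linarith
    rw [if_neg e1, if_neg e2, if_pos hodd]; ring
  unfold probAwayC
  rw [hX, hr]; push_cast; field_simp

omit [FloorRing K] in
/-- `1 − 2^−(N+1) ≤ 1`. -/
theorem one_sub_half_pow_le_one (N : ℕ) : 1 - (1 : K) / 2 ^ (N + 1) ≤ 1 := by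
  have : (0 : K) < 1 / 2 ^ (N + 1) := by positivity
  linarith

/-- Rule `A`, `N` bits, negative state with `θ = 2^−(N+1)`: up-probability `2θ` (doubled). -/
theorem pUpQ_A_neg_half {F : Finset K} {c : K} {N : ℕ} (hdn : dn F c < 0)
    (hθ : pUp F c = 1 / 2 ^ (N + 1)) : pUpQ F (probAwayA N) c = 2 / 2 ^ (N + 1) := by
  rw [pUpQ_of_dn_neg F _ hdn, hθ, probAwayA_one_sub_half, pow_succ]; field_simp; ring

/-- Rule `B`, `N` bits, negative state with `θ = 2^−(N+1)`: never rounds up. -/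
theorem pUpQ_B_neg_half {F : Finset K} {c : K} {N : ℕ} (hdn : dn F c < 0)
    (hθ : pUp F c = 1 / 2 ^ (N + 1)) : pUpQ F (probAwayB N) c = 0 := by
  rw [pUpQ_of_dn_neg F _ hdn, hθ, probAwayB_eq_one N le_rfl (one_sub_half_pow_le_one N), sub_self]

/-- Rule `C`, `N ≥ 1` bits, negative state with `θ = 2^−(N+1)`: never rounds up. -/
theorem pUpQ_C_neg_half {F : Finset K} {c : K} {N : ℕ} (hN : 1 ≤ N) (hdn : dn F c < 0)
    (hθ : pUp F c = 1 / 2 ^ (N + 1)) : pUpQ F (probAwayC N) c = 0 := by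
  rw [pUpQ_of_dn_neg F _ hdn, hθ, probAwayC_one_sub_half hN, sub_self]

omit [FloorRing K] in
/-- Mean under a rule with doubled up-probability: `c̄ + (c̄ − ⌊c̄⌋)` (error `+θ·gap`). -/
theorem stepQ_id_of_pUpQ_two_mul {F : Finset K} {q : K → K} {c : K} (h0 : pUp F c ≠ 0)
    (h2 : pUpQ F q c = 2 * pUp F c) :
    stepQ F q c (fun t => t) = clamp F c + (clamp F c - dn F c) := by
  rw [stepQ_id_eq, h2, ← pUp_mul_gap (dn_ne_up_of_pUp_ne_zero h0)]; ring

omit [FloorRing K] in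
/-- Mean under a rule that never rounds up: `⌊c̄⌋` (error `−θ·gap`). -/
theorem stepQ_id_of_pUpQ_zero {F : Finset K} {q : K → K} {c : K} (h0 : pUp F c ≠ 0)
    (hz : pUpQ F q c = 0) : stepQ F q c (fun t => t) = dn F c := by
  have := pUp_mul_gap (dn_ne_up_of_pUp_ne_zero h0)
  rw [stepQ_id_eq, hz]; linarith

/-- **One bit short at a negative state, the three rules.** `θ = pUp F c = 2^−(N+1)`, `dn F c < 0`,
`N ≥ 1`: rule `A`'s mean is `c̄ + (c̄ − ⌊c̄⌋)` (it rounds up with probability `2θ`), rules `B` and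
`C` return `⌊c̄⌋` surely; the exact-SR mean is `c̄`. -/
theorem stepQ_ABC_id_neg_half {F : Finset K} {c : K} {N : ℕ} (hN : 1 ≤ N) (hdn : dn F c < 0)
    (hθ : pUp F c = 1 / 2 ^ (N + 1)) :
    stepQ F (probAwayA N) c (fun t => t) = clamp F c + (clamp F c - dn F c) ∧
    stepQ F (probAwayB N) c (fun t => t) = dn F c ∧
    stepQ F (probAwayC N) c (fun t => t) = dn F c := by
  have h0 : pUp F c ≠ 0 := by rw [hθ]; positivity
  refine ⟨stepQ_id_of_pUpQ_two_mul h0 ?_, stepQ_id_of_pUpQ_zero h0 (pUpQ_B_neg_half hdn hθ),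
    stepQ_id_of_pUpQ_zero h0 (pUpQ_C_neg_half hN hdn hθ)⟩
  rw [pUpQ_A_neg_half hdn hθ, hθ]; ring

omit [IsStrictOrderedRing K] [FloorRing K] in
/-- Rule-independent congruence: the integrand matters only on `F`. -/
theorem stepQ_congr_mem {F : Finset K} (hF : F.Nonempty) (q : K → K) (c : K) {f g : K → K}
    (h : ∀ a ∈ F, f a = g a) : stepQ F q c f = stepQ F q c g := by
  unfold stepQ; rw [h _ (up_mem hF c), h _ (dn_mem hF c)]

end Generic

end Summit.Ventures.CertifiedArithmetic.LowPrec.SR.LimitedBits
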